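import Summits.Ventures.Crystal3D.Theorems.StickyWulffConstantStackingLiminfMollifierRegularity
import HarnessLib

/-!
# Pointwise algebra of the skew bound (step S4(ii) of stub (B) `stub_mollifiedUpper`, line `LayerChain`
# v4, crux `StackingLiminf`, stmt-Ventures-19145)

Route `StickyWulffConstant` of the venture `Summits/Ventures/Crystal3D` (cell `crystal3d-full`).
Three small lemmas used by the skew bound `∫|V⁻ − f̄ v| ≤ C(KD + N/K)`:
* `card_layers_le` — at most `4K` layers `k` satisfy `|t − k·√(2/3)| < K` (`K ≥ 1`);
* `abs_occSkew_le` — OCCUPIED/VACANT algebra: for nonnegative weights `φ` on a finite index set `F`,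
  an "occupied" subset `O ⊆ F`, a sub-family selector `m` and `f̄ ∈ [0,1]`:
  `|Σ_{O,m} φ − f̄ Σ_O φ| ≤ Σ_O φ` and `≤ Σ_{F∖O} φ + |Σ_{F,m} φ − f̄ Σ_F φ|`;
* `abs_le_four_mul_of_halves` — `|E| ≤ v`, `|E| ≤ u + e`, `v + u ≥ ½`, all nonnegative ⇒ `|E| ≤ 4vu + 4ve`.
WHAT THIS IS NOT: not the skew bound; rung F-C1 not moved.
-/

noncomputable section

namespace Summit.Ventures.Crystal3D.Theorems.PlateauHeight

open Finset

/-- **At most `4K` layers meet a vertical `K`-window** (`K ≥ 1`, layer spacing `√(2/3) > 4/5`). -/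
theorem card_layers_le {K : ℝ} (hK : 1 ≤ K) (t : ℝ) :
    (((finite_layers t K).toFinset).card : ℝ) ≤ 4 * K := by
  set h : ℝ := Real.sqrt (2 / 3) with hh
  have hh0 : (4 : ℝ) / 5 < h := by
    rw [hh, show (4 : ℝ) / 5 = Real.sqrt ((4 / 5) ^ 2) by rw [Real.sqrt_sq (by norm_num)]]
    exact Real.sqrt_lt_sqrt (by norm_num) (by norm_num)
  have hpos : 0 < h := by linarith
  have hsub : (finite_layers t K).toFinset ⊆ Finset.Icc ⌈(t - K) / h⌉ ⌊(t + K) / h⌋ := by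
    intro k hk
    rw [Set.Finite.mem_toFinset, Set.mem_setOf_eq] at hk
    rw [abs_lt] at hk
    rw [Finset.mem_Icc, Int.ceil_le, Int.le_floor, div_le_iff₀ hpos, le_div_iff₀ hpos]
    constructor <;> linarith
  have hcard := Finset.card_le_card hsub
  have h1 : ((Finset.Icc ⌈(t - K) / h⌉ ⌊(t + K) / h⌋).card : ℝ) ≤ 4 * K := by
    rw [Int.card_Icc]
    have hfl : (⌊(t + K) / h⌋ : ℝ) ≤ (t + K) / h := Int.floor_le _
    have hce : (t - K) / h ≤ (⌈(t - K) / h⌉ : ℝ) := Int.le_ceil _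
    have hdiff : ((⌊(t + K) / h⌋ + 1 - ⌈(t - K) / h⌉ : ℤ) : ℝ) ≤ 2 * K / h + 1 := by
      push_cast
      have : (t + K) / h - (t - K) / h = 2 * K / h := by field_simp; ring
      linarith
    have h2K : 2 * K / h ≤ 5 / 2 * K := by
      rw [div_le_iff₀ hpos]; nlinarith
    rcases le_or_gt 0 (⌊(t + K) / h⌋ + 1 - ⌈(t - K) / h⌉) with hnn | hneg
    · have : (((⌊(t + K) / h⌋ + 1 - ⌈(t - K) / h⌉).toNat : ℤ) : ℝ) =
          ((⌊(t + K) / h⌋ + 1 - ⌈(t - K) / h⌉ : ℤ) : ℝ) := by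
        rw [Int.toNat_of_nonneg hnn]
      have e : (((⌊(t + K) / h⌋ + 1 - ⌈(t - K) / h⌉).toNat : ℕ) : ℝ) =
          (((⌊(t + K) / h⌋ + 1 - ⌈(t - K) / h⌉).toNat : ℤ) : ℝ) := by norm_cast
      rw [e, this]; linarith
    · rw [Int.toNat_of_nonpos hneg.le]; simp; linarith
  have hcardR : (((finite_layers t K).toFinset).card : ℝ) ≤
      ((Finset.Icc ⌈(t - K) / h⌉ ⌊(t + K) / h⌋).card : ℝ) := by exact_mod_cast hcard
  exact hcardR.trans h1

/-- **Occupied/vacant algebra of the skew.**  `φ ≥ 0` on `F`, `O ⊆ F`, `0 ≤ f̄ ≤ 1`: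
`|Σ_{t∈O, m t} φ t − f̄ Σ_{t∈O} φ t| ≤ Σ_{t∈O} φ t` and
`≤ Σ_{t ∈ F∖O} φ t + |Σ_{t∈F, m t} φ t − f̄ Σ_{t∈F} φ t|`. -/
theorem abs_occSkew_le {ι : Type*} [DecidableEq ι] (F O : Finset ι) (hOF : O ⊆ F) (φ : ι → ℝ)
    (hφ : ∀ t ∈ F, 0 ≤ φ t) (m : ι → Prop) [DecidablePred m] {fb : ℝ} (hf0 : 0 ≤ fb) (hf1 : fb ≤ 1) :
    |(∑ t ∈ O.filter m, φ t) - fb * ∑ t ∈ O, φ t| ≤ ∑ t ∈ O, φ t ∧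
    |(∑ t ∈ O.filter m, φ t) - fb * ∑ t ∈ O, φ t| ≤
      (∑ t ∈ F \ O, φ t) + |(∑ t ∈ F.filter m, φ t) - fb * ∑ t ∈ F, φ t| := by
  have hφO : ∀ t ∈ O, 0 ≤ φ t := fun t ht => hφ t (hOF ht)
  have hocc0 : 0 ≤ ∑ t ∈ O, φ t := Finset.sum_nonneg hφO
  have hoccm0 : 0 ≤ ∑ t ∈ O.filter m, φ t := Finset.sum_nonneg fun t ht => hφO t (mem_of_mem_filter t ht)
  have hoccm_le : ∑ t ∈ O.filter m, φ t ≤ ∑ t ∈ O, φ t :=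
    Finset.sum_le_sum_of_subset_of_nonneg (filter_subset _ _) fun t ht _ => hφO t ht
  -- vacant parts
  have hsplit : ∑ t ∈ F, φ t = (∑ t ∈ O, φ t) + ∑ t ∈ F \ O, φ t := by
    rw [← Finset.sum_union disjoint_sdiff, union_sdiff_of_subset hOF]
  have hsplitm : ∑ t ∈ F.filter m, φ t = (∑ t ∈ O.filter m, φ t) + ∑ t ∈ (F \ O).filter m, φ t := by
    rw [← Finset.sum_union]
    · congr 1
      rw [← filter_union, union_sdiff_of_subset hOF]
    · exact disjoint_filter_filter disjoint_sdiff
  have hu0 : 0 ≤ ∑ t ∈ F \ O, φ t := Finset.sum_nonneg fun t ht => hφ t (mem_sdiff.1 ht).1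
  have hum0 : 0 ≤ ∑ t ∈ (F \ O).filter m, φ t :=
    Finset.sum_nonneg fun t ht => hφ t (mem_sdiff.1 (mem_of_mem_filter t ht)).1
  have hum_le : ∑ t ∈ (F \ O).filter m, φ t ≤ ∑ t ∈ F \ O, φ t :=
    Finset.sum_le_sum_of_subset_of_nonneg (filter_subset _ _) fun t ht _ => hφ t (mem_sdiff.1 ht).1
  constructor
  · rw [abs_le]
    constructor
    · nlinarith
    · nlinarith
  · rw [hsplit, hsplitm]
    have key : (∑ t ∈ O.filter m, φ t) - fb * ∑ t ∈ O, φ t =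
        ((∑ t ∈ O.filter m, φ t) + ∑ t ∈ (F \ O).filter m, φ t -
          fb * ((∑ t ∈ O, φ t) + ∑ t ∈ F \ O, φ t)) -
        ((∑ t ∈ (F \ O).filter m, φ t) - fb * ∑ t ∈ F \ O, φ t) := by ring
    rw [key]
    refine (abs_sub _ _).trans ?_
    have hlast : |(∑ t ∈ (F \ O).filter m, φ t) - fb * ∑ t ∈ F \ O, φ t| ≤ ∑ t ∈ F \ O, φ t := by
      rw [abs_le]; constructor <;> nlinarith
    linarith

/-- `|E| ≤ v`, `|E| ≤ u + e`, `v + u ≥ ½`, `v,u,e ≥ 0` ⇒ `|E| ≤ 4vu + 4ve`. -/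
theorem abs_le_four_mul_of_halves {E v u e : ℝ} (hv : 0 ≤ v) (hu : 0 ≤ u) (he : 0 ≤ e)
    (h1 : |E| ≤ v) (h2 : |E| ≤ u + e) (h3 : 1 / 2 ≤ v + u) : |E| ≤ 4 * v * u + 4 * v * e := by
  rcases le_or_gt (1 / 4) u with hu4 | hu4
  · -- `u ≥ 1/4`: `|E| ≤ v ≤ 4 v u`
    nlinarith [abs_nonneg E]
  · -- `u < 1/4`: `v ≥ 1/4`, `|E| ≤ u + e ≤ 4v(u + e)`
    have hv4 : 1 / 4 ≤ v := by linarith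
    nlinarith [abs_nonneg E]

end Summit.Ventures.Crystal3D.Theorems.PlateauHeight

end
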